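import Summits.HubbardSuperconductivity.HubbardSuperconductivity.Theorems.ThermalWedgeTwSeededEnsembleEquivalenceOfDifferentiablePressure
import Summits.HubbardSuperconductivity.HubbardSuperconductivity.Theorems.ThermalWedgeTwSeededEnsembleEquivalenceAhmTransfer
import Summits.HubbardSuperconductivity.HubbardSuperconductivity.Theorems.ThermalWedgeTwApproximatingHamiltonian
import Summits.HubbardSuperconductivity.HubbardSuperconductivity.Theorems.TwSeededEnsembleEquivalence.Negative.HullTouchNormalForm

/-!
# Crux `TwSeededEnsembleEquivalenceR` (stmt-HubbardSuperconductivity-15581) — the COLD SLICE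
# (line `cold-floor-collapse`, lead gen 1): R is a one-temperature statement

Support file (`--supports stmt-HubbardSuperconductivity-15581`; sorry-free; no definition; imports the
route file only to name the crux `TwSeededEnsembleEquivalenceR`).

The repaired ensemble crux R asks the canonical/grand-canonical defect bound
`e_L(g) + p_L(β,μ,g) − μ n_L ≤ log 4/β + ε` of the d-wave-seeded torus on the thermal window
`1 ≤ β ≤ e^{a/U}`, seeds `g ∈ [K'U, 1/10]`, for SOME `a, K', U₀ > 0`. By Template D
(`twSeededEnsembleEquivalence_instance_anti_beta`: at fixed `μ, L` the defect minus the allowance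
`log 4/β` is non-decreasing in `β`) the whole window is carried by its coldest slice `β = e^{a/U}`:

* `twR_iff_coldSlice` — R ⟺ R at `β = e^{a/U}` only (`μ` may then be taken `β`-independent);
* `twR_of_coldDifferentiablePressure` — (TDL)+(DIFF)+(EDGE) of the infinite-volume SEEDED pressure at the
  single inverse temperature `β = e^{a/U}` (for each admissible `U, g`) ⟹ R, through the landed per-instance
  closer `bdl_cruxInstance_of_differentiablePressure` (stubs A–F of line exposed-density-duality);
* `twR_of_coldSecantBracket` — the finite-volume shape: the two-sided `μ`-secant bracket of the SOURCED
  Bogoliubov functional `⨆_h [p̃_L(β,μ,h) − h²/g]` at `β = e^{a/U}` only ⟹ R (AHM item 1703 +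
  `stub_ahmTransfer` + `bdl_cruxInstance_of_bracket`);
* `twR_of_hullTouchT0Floor` / `twR_of_hullTouchT0FloorWeak` — the temperature-free sufficient condition:
  the T = 0 hull touch of the seeded sector staircase at `N_L` on FLOOR seeds `g ∈ [K'U, 1/10]` gives R for
  every exponent `a` (here `a = 1`), spending the allowance on `log Re Z_β ≤ L² log 4 − β E₀`;
* `hullDefect_le_of_twR` — conversely R forces the T = 0 hull defect at its `μ` to be
  `≤ (log 4 · e^{−a/U} + κ) L²` eventually: R sits between the T = 0 hull touch on floor seeds and the
  same statement with an exponentially small tolerance.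

So the physics input of R is needed at ONE temperature `T_U = e^{−a/U}` per `(U, g)` — the regime where
(card cold-floor-collapse) the seed floor pins every near-optimal pair source far above `T_U`.
[folklore compositions]
-/

set_option linter.dupNamespace false

namespace Summit.HubbardSuperconductivity.HubbardSuperconductivity.Theorems.TwSeededEnsembleEquivalenceR.ColdFloor

open Matrix Filter Topology Finset Literature.MathematicalPhysics.QuantumLattice
open Summit.HubbardSuperconductivity.HubbardSuperconductivity.Theses.ThermalWedge
open Summit.HubbardSuperconductivity.HubbardSuperconductivity.Theorems.TwSeededEnsembleEquivalence.Negative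
open Summit.HubbardSuperconductivity.HubbardSuperconductivity.Theorems.TwSeededEnsembleEquivalence.ThermalDuality
open scoped ComplexOrder

noncomputable section

/-- `1 ≤ e^{a/U}` for `0 < a`, `0 < U`. -/
theorem one_le_exp_div {a U : ℝ} (ha : 0 < a) (hU : 0 < U) : (1 : ℝ) ≤ Real.exp (a / U) :=
  Real.one_le_exp (div_pos ha hU).le

/-- **(C1) The cold slice.** `TwSeededEnsembleEquivalenceR` is EQUIVALENT to its restriction to the single
coldest inverse temperature `β = e^{a/U}` of its window (with `μ` chosen before `ε`, independently of `β`).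
(⇒: specialise; ⇐: Template D `twSeededEnsembleEquivalence_instance_anti_beta`, same `μ, ε, L₀`.) [folklore] -/
theorem twR_iff_coldSlice :
    TwSeededEnsembleEquivalenceR ↔
      ∀ δ ∈ Set.Icc (1/10 : ℝ) (2/5 : ℝ), ∃ μ₁ μ₂ : ℝ, -4 < μ₁ ∧ μ₁ ≤ μ₂ ∧ μ₂ < 0 ∧
        ∃ a K' U₀ : ℝ, 0 < a ∧ 0 < K' ∧ 0 < U₀ ∧ ∀ U ∈ Set.Ioc (0 : ℝ) U₀,
          ∀ g ∈ Set.Icc (K' * U) (1 / 10),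
            ∃ μ ∈ Set.Icc μ₁ μ₂, ∀ ε : ℝ, 0 < ε → ∃ L₀ : ℕ, ∀ (L : ℕ) [NeZero L], L₀ ≤ L →
              ((hubbardTorus 2 L 1 U - ((g / (L : ℝ) ^ 2 : ℝ) : ℂ) •
                ((pairField dWaveFormFactor L)ᴴ * pairField dWaveFormFactor L)).minEnergyOn
                  (szSector (Λ := FermionTorus 2 L) (2 * ⌊(1 - δ) * (L : ℝ) ^ 2 / 2⌋₊) 0) /
                    (L : ℝ) ^ 2) +
                (Real.log (Matrix.partitionFn (Real.exp (a / U)) (hubbardTorusWith 2 L 1 U μ -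
                  ((g / (L : ℝ) ^ 2 : ℝ) : ℂ) •
                    ((pairField dWaveFormFactor L)ᴴ * pairField dWaveFormFactor L))).re /
                      (Real.exp (a / U) * (L : ℝ) ^ 2)) -
                μ * ((2 * ⌊(1 - δ) * (L : ℝ) ^ 2 / 2⌋₊) : ℝ) / (L : ℝ) ^ 2 ≤
                  Real.log 4 / Real.exp (a / U) + ε := by
  constructor
  · intro h δ hδ
    obtain ⟨μ₁, μ₂, hμ₁, hμ₁₂, hμ₂, a, K', U₀, ha, hK', hU₀, hmain⟩ := h δ hδ
    refine ⟨μ₁, μ₂, hμ₁, hμ₁₂, hμ₂, a, K', U₀, ha, hK', hU₀, fun U hU g hg => ?_⟩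
    exact hmain U hU g hg (Real.exp (a / U)) (one_le_exp_div ha hU.1) le_rfl
  · intro h δ hδ
    obtain ⟨μ₁, μ₂, hμ₁, hμ₁₂, hμ₂, a, K', U₀, ha, hK', hU₀, hmain⟩ := h δ hδ
    refine ⟨μ₁, μ₂, hμ₁, hμ₁₂, hμ₂, a, K', U₀, ha, hK', hU₀, fun U hU g hg β hβ hβa => ?_⟩
    obtain ⟨μ, hμ, hcold⟩ := hmain U hU g hg
    refine ⟨μ, hμ, fun ε hε => ?_⟩
    obtain ⟨L₀, hL₀⟩ := hcold ε hε
    refine ⟨L₀, fun L _ hL => ?_⟩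
    exact twSeededEnsembleEquivalence_instance_anti_beta L U μ g _ _ (lt_of_lt_of_le one_pos hβ) hβa
      (hL₀ L hL)

/-- **R from (TDL)+(DIFF)+(EDGE) of the infinite-volume seeded pressure AT THE COLD SLICE ONLY.**
If for every `δ` in the window there are a `δ`-window `[μ₁, μ₂] ⊂ (−4, 0)` and `a, K', U₀ > 0` such that for
all `U ∈ (0, U₀]`, `g ∈ [K'U, 1/10]`, at the ONE inverse temperature `β = e^{a/U}` the seeded pressure
`p_L(β, ·)` has a pointwise limit `b` on `[μ₁, μ₂]` (TDL), differentiable on `(μ₁, μ₂)` (DIFF), with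
`b′(μm) ≤ 1 − δ ≤ b′(μp)` at two interior points (EDGE), then `TwSeededEnsembleEquivalenceR` holds.
(Per-instance closer `bdl_cruxInstance_of_differentiablePressure` at `β = e^{a/U}`, then the cold slice.)
[folklore] -/
theorem twR_of_coldDifferentiablePressure : (∀ δ ∈ Set.Icc (1/10 : ℝ) (2/5 : ℝ), ∃ μ₁ μ₂ : ℝ, -4 < μ₁ ∧ μ₁ ≤ μ₂ ∧ μ₂ < 0 ∧ ∃ a K' U₀ : ℝ, 0 < a ∧ 0 < K' ∧ 0 < U₀ ∧ ∀ U ∈ Set.Ioc (0 : ℝ) U₀, ∀ g ∈ Set.Icc (K' * U) (1 / 10), ∃ (b : ℝ → ℝ) (μm μp : ℝ), (∀ μ ∈ Set.Icc μ₁ μ₂, ∀ κ : ℝ, 0 < κ → ∃ L₀ : ℕ, ∀ (L : ℕ) [NeZero L], L₀ ≤ L → |Real.log (Matrix.partitionFn (Real.exp (a / U)) (hubbardTorusWith 2 L 1 U μ - ((g / (L : ℝ) ^ 2 : ℝ) : ℂ) • ((pairField dWaveFormFactor L)ᴴ * pairField dWaveFormFactor L))).re / (Real.exp (a / U) * (L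 : ℝ) ^ 2) - b μ| ≤ κ) ∧ (∀ μ ∈ Set.Ioo μ₁ μ₂, DifferentiableAt ℝ b μ) ∧ μm ∈ Set.Ioo μ₁ μ₂ ∧ μp ∈ Set.Ioo μ₁ μ₂ ∧ deriv b μm ≤ 1 - δ ∧ 1 - δ ≤ deriv b μp) → TwSeededEnsembleEquivalenceR := by
  intro hP
  rw [twR_iff_coldSlice]
  intro δ hδ
  obtain ⟨μ₁, μ₂, hμ₁, hμ₁₂, hμ₂, a, K', U₀, ha, hK', hU₀, hmain⟩ := hP δ hδ
  refine ⟨μ₁, μ₂, hμ₁, hμ₁₂, hμ₂, a, K', U₀, ha, hK', hU₀, fun U hU g hg => ?_⟩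
  have hg0 : 0 ≤ g := (mul_pos hK' hU.1).le.trans hg.1
  exact bdl_cruxInstance_of_differentiablePressure δ U g (Real.exp (a / U)) μ₁ μ₂ hδ
    (one_le_exp_div ha hU.1) hg0 (hmain U hU g hg)

/-- **R from the finite-volume secant bracket of the SOURCED Bogoliubov functional AT THE COLD SLICE ONLY.**
For every `δ` in the window: a `δ`-window, `a, K', U₀ > 0`, and for all admissible `U, g` an
`L`-independent `μ₀ ∈ [μ₁, μ₂]` at which `B̃_L(β, μ) = ⨆_h [p̃_L(β, μ, h) − h²/g]`
(`p̃_L(β,μ,h) = log Re Z(β, dWaveSourceTorus L U μ h)/(βL²)`), `β = e^{a/U}`, has both one-sided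
`μ`-secants within `η` of `1 − δ` eventually in `L`, for every `η > 0` ⟹ `TwSeededEnsembleEquivalenceR`.
(Item 1703 `twApproximatingHamiltonian_proof` + `stub_ahmTransfer` move the bracket to the seeded pressure;
`bdl_cruxInstance_of_bracket` closes the cold instance; then the cold slice.) [folklore] -/
theorem twR_of_coldSecantBracket
    (hG : ∀ δ ∈ Set.Icc (1/10 : ℝ) (2/5 : ℝ), ∃ μ₁ μ₂ : ℝ, -4 < μ₁ ∧ μ₁ ≤ μ₂ ∧ μ₂ < 0 ∧
      ∃ a K' U₀ : ℝ, 0 < a ∧ 0 < K' ∧ 0 < U₀ ∧ ∀ U ∈ Set.Ioc (0 : ℝ) U₀,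
        ∀ g ∈ Set.Icc (K' * U) (1 / 10),
          ∃ μ₀ ∈ Set.Icc μ₁ μ₂, ∀ η : ℝ, 0 < η → ∃ τ : ℝ, 0 < τ ∧ ∃ L₀ : ℕ, ∀ (L : ℕ) [NeZero L], L₀ ≤ L →
            ((⨆ h : ℝ, ((Real.log (Matrix.partitionFn (Real.exp (a / U)) (dWaveSourceTorus L U (μ₀ + τ) h)).re /
                (Real.exp (a / U) * (L : ℝ) ^ 2)) - h ^ 2 / g)) -
              (⨆ h : ℝ, ((Real.log (Matrix.partitionFn (Real.exp (a / U)) (dWaveSourceTorus L U μ₀ h)).re /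
                (Real.exp (a / U) * (L : ℝ) ^ 2)) - h ^ 2 / g))) / τ ≤ (1 - δ) + η ∧
            (1 - δ) - η ≤
            ((⨆ h : ℝ, ((Real.log (Matrix.partitionFn (Real.exp (a / U)) (dWaveSourceTorus L U μ₀ h)).re /
                (Real.exp (a / U) * (L : ℝ) ^ 2)) - h ^ 2 / g)) -
              (⨆ h : ℝ, ((Real.log (Matrix.partitionFn (Real.exp (a / U)) (dWaveSourceTorus L U (μ₀ - τ) h)).re /
                (Real.exp (a / U) * (L : ℝ) ^ 2)) - h ^ 2 / g))) / τ) :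
    TwSeededEnsembleEquivalenceR := by
  rw [twR_iff_coldSlice]
  intro δ hδ
  obtain ⟨μ₁, μ₂, hμ₁, hμ₁₂, hμ₂, a, K', U₀, ha, hK', hU₀, hmain⟩ := hG δ hδ
  refine ⟨μ₁, μ₂, hμ₁, hμ₁₂, hμ₂, a, K', U₀, ha, hK', hU₀, fun U hU g hg => ?_⟩
  obtain ⟨μ₀, hμ₀, hbrB⟩ := hmain U hU g hg
  have hβ1 : (1 : ℝ) ≤ Real.exp (a / U) := one_le_exp_div ha hU.1
  have hβ0 : 0 < Real.exp (a / U) := Real.exp_pos _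
  have hg0 : 0 < g := lt_of_lt_of_le (mul_pos hK' hU.1) hg.1
  have hbr := stub_ahmTransfer δ U g (Real.exp (a / U)) μ₀ hg0 hβ0 twApproximatingHamiltonian_proof hbrB
  exact ⟨μ₀, hμ₀, bdl_cruxInstance_of_bracket δ U g (Real.exp (a / U)) μ₀ hδ hβ1 hg0.le hbr⟩

/-- **Per-instance form of (C2): a T = 0 hull touch gives the crux instance at every `β > 0`.**
If at `(U, g, μ, L)` the seeded sector energy at `N_L` is supported by the slope `μ` up to `κ L²`,
`E_{N_L} − μ N_L ≤ E₀(H_can − μ N̂) + κ L²`, then the defect inequality holds at every `β > 0` with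
`ε = κ` (spend the allowance: `log Re Z_β ≤ L² log 4 − β E₀`). [folklore] -/
theorem instance_of_hullTouch (L : ℕ) [NeZero L] {δ U g μ β κ : ℝ} (hβ : 0 < β)
    (hT : (hubbardTorus 2 L 1 U - ((g / (L : ℝ) ^ 2 : ℝ) : ℂ) •
          ((pairField dWaveFormFactor L)ᴴ * pairField dWaveFormFactor L)).minEnergyOn
          (szSector (Λ := FermionTorus 2 L) (2 * ⌊(1 - δ) * (L : ℝ) ^ 2 / 2⌋₊) 0) -
          μ * (2 * (⌊(1 - δ) * (L : ℝ) ^ 2 / 2⌋₊ : ℝ)) ≤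
        (hubbardTorusWith 2 L 1 U μ - ((g / (L : ℝ) ^ 2 : ℝ) : ℂ) •
          ((pairField dWaveFormFactor L)ᴴ * pairField dWaveFormFactor L)).groundEnergy +
          κ * (L : ℝ) ^ 2) :
    ((hubbardTorus 2 L 1 U - ((g / (L : ℝ) ^ 2 : ℝ) : ℂ) •
        ((pairField dWaveFormFactor L)ᴴ * pairField dWaveFormFactor L)).minEnergyOn
          (szSector (Λ := FermionTorus 2 L) (2 * ⌊(1 - δ) * (L : ℝ) ^ 2 / 2⌋₊) 0) / (L : ℝ) ^ 2) +
      (Real.log (Matrix.partitionFn β (hubbardTorusWith 2 L 1 U μ - ((g / (L : ℝ) ^ 2 : ℝ) : ℂ) •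
        ((pairField dWaveFormFactor L)ᴴ * pairField dWaveFormFactor L))).re / (β * (L : ℝ) ^ 2)) -
      μ * ((2 * ⌊(1 - δ) * (L : ℝ) ^ 2 / 2⌋₊) : ℝ) / (L : ℝ) ^ 2 ≤ Real.log 4 / β + κ := by
  have hLpos : (0 : ℝ) < (L : ℝ) ^ 2 := cast_sq_pos_of_neZero L
  have hL0 : (L : ℝ) ≠ 0 := fun h0 => by rw [h0] at hLpos; simp at hLpos
  set Z := Real.log ((hubbardTorusWith 2 L 1 U μ - ((g / (L : ℝ) ^ 2 : ℝ) : ℂ) •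
      ((pairField dWaveFormFactor L)ᴴ * pairField dWaveFormFactor L)).partitionFn β).re
  set A := (hubbardTorus 2 L 1 U - ((g / (L : ℝ) ^ 2 : ℝ) : ℂ) •
      ((pairField dWaveFormFactor L)ᴴ * pairField dWaveFormFactor L)).minEnergyOn
      (szSector (Λ := FermionTorus 2 L) (2 * ⌊(1 - δ) * (L : ℝ) ^ 2 / 2⌋₊) 0)
  set E₀ := (hubbardTorusWith 2 L 1 U μ - ((g / (L : ℝ) ^ 2 : ℝ) : ℂ) •
      ((pairField dWaveFormFactor L)ᴴ * pairField dWaveFormFactor L)).groundEnergy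
  set ν := 2 * (⌊(1 - δ) * (L : ℝ) ^ 2 / 2⌋₊ : ℝ)
  have hZ : Z ≤ (L : ℝ) ^ 2 * Real.log 4 - β * E₀ := by
    have := log_partitionFn_le_log_card_sub (isHermitian_seededGC L U μ g) hβ.le
    rwa [log_card_fock] at this
  have hZ' : Z / (β * (L : ℝ) ^ 2) ≤ Real.log 4 / β - E₀ / (L : ℝ) ^ 2 := by
    rw [div_le_iff₀ (mul_pos hβ hLpos)]
    have : (Real.log 4 / β - E₀ / (L : ℝ) ^ 2) * (β * (L : ℝ) ^ 2) =
        (L : ℝ) ^ 2 * Real.log 4 - β * E₀ := by field_simp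
    linarith
  have hE : E₀ / (L : ℝ) ^ 2 ≥ (A - μ * ν) / (L : ℝ) ^ 2 - κ := by
    have h1 : (A - μ * ν) / (L : ℝ) ^ 2 ≤ (E₀ + κ * (L : ℝ) ^ 2) / (L : ℝ) ^ 2 :=
      div_le_div_of_nonneg_right hT hLpos.le
    have h2 : (E₀ + κ * (L : ℝ) ^ 2) / (L : ℝ) ^ 2 = E₀ / (L : ℝ) ^ 2 + κ := by
      field_simp
    linarith
  have h3 : (A - μ * ν) / (L : ℝ) ^ 2 = A / (L : ℝ) ^ 2 - μ * ν / (L : ℝ) ^ 2 := by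
    rw [sub_div]
  linarith

/-- **(C2) R from the T = 0 hull touch on FLOOR seeds** (strong form `∃ μ ∀ κ`): if for every `δ` in the
window there are a `δ`-window `[μ₁, μ₂] ⊂ (−4, 0)` and `K', U₀ > 0` such that for all `U ∈ (0, U₀]` and all
floor seeds `g ∈ [K'U, 1/10]` ONE slope `μ ∈ [μ₁, μ₂]` asymptotically supports the seeded sector staircase
at `N_L` (`E_{N_L} − μ N_L ≤ E₀(H_can − μN̂) + κ L²` for every `κ > 0`, eventually in `L`), then
`TwSeededEnsembleEquivalenceR` holds — with ANY exponent, here `a = 1`. (This is the predecessor's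
`HullTouchT0Strong` restricted to floor seeds: not hit by the η-pairing barrier, which needs
`U/(2g) ∈ (1/2, 1)`.) [folklore] -/
theorem twR_of_hullTouchT0Floor
    (hH : ∀ δ ∈ Set.Icc (1/10 : ℝ) (2/5 : ℝ), ∃ μ₁ μ₂ : ℝ, -4 < μ₁ ∧ μ₁ ≤ μ₂ ∧ μ₂ < 0 ∧
      ∃ K' U₀ : ℝ, 0 < K' ∧ 0 < U₀ ∧ ∀ U ∈ Set.Ioc (0 : ℝ) U₀, ∀ g ∈ Set.Icc (K' * U) (1 / 10),
        ∃ μ ∈ Set.Icc μ₁ μ₂, ∀ κ : ℝ, 0 < κ → ∃ L₀ : ℕ, ∀ (L : ℕ) [NeZero L], L₀ ≤ L →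
          (hubbardTorus 2 L 1 U - ((g / (L : ℝ) ^ 2 : ℝ) : ℂ) •
              ((pairField dWaveFormFactor L)ᴴ * pairField dWaveFormFactor L)).minEnergyOn
              (szSector (Λ := FermionTorus 2 L) (2 * ⌊(1 - δ) * (L : ℝ) ^ 2 / 2⌋₊) 0) -
              μ * (2 * (⌊(1 - δ) * (L : ℝ) ^ 2 / 2⌋₊ : ℝ)) ≤
            (hubbardTorusWith 2 L 1 U μ - ((g / (L : ℝ) ^ 2 : ℝ) : ℂ) •
              ((pairField dWaveFormFactor L)ᴴ * pairField dWaveFormFactor L)).groundEnergy +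
              κ * (L : ℝ) ^ 2) :
    TwSeededEnsembleEquivalenceR := by
  intro δ hδ
  obtain ⟨μ₁, μ₂, hμ₁, hμ₁₂, hμ₂, K', U₀, hK', hU₀, hmain⟩ := hH δ hδ
  refine ⟨μ₁, μ₂, hμ₁, hμ₁₂, hμ₂, 1, K', U₀, one_pos, hK', hU₀, fun U hU g hg β hβ _ => ?_⟩
  obtain ⟨μ, hμ, hT⟩ := hmain U hU g hg
  refine ⟨μ, hμ, fun ε hε => ?_⟩
  obtain ⟨L₀, hL₀⟩ := hT ε hε
  exact ⟨L₀, fun L _ hL => instance_of_hullTouch L (lt_of_lt_of_le one_pos hβ) (hL₀ L hL)⟩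

/-- **(C2), weak form (`∀ κ ∃ μ`):** the same with the slope `μ ∈ [μ₁, μ₂]` allowed to depend on the
tolerance `κ`; the compactness upgrade `seeded_hullTouchT0Strong_of_hullTouchT0` (Bolzano–Weierstrass in
the window + `2L²`-Lipschitz in `μ`) reduces it to the strong form. [folklore] -/
theorem twR_of_hullTouchT0FloorWeak
    (hH : ∀ δ ∈ Set.Icc (1/10 : ℝ) (2/5 : ℝ), ∃ μ₁ μ₂ : ℝ, -4 < μ₁ ∧ μ₁ ≤ μ₂ ∧ μ₂ < 0 ∧
      ∃ K' U₀ : ℝ, 0 < K' ∧ 0 < U₀ ∧ ∀ U ∈ Set.Ioc (0 : ℝ) U₀, ∀ g ∈ Set.Icc (K' * U) (1 / 10),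
        ∀ κ : ℝ, 0 < κ → ∃ μ ∈ Set.Icc μ₁ μ₂, ∃ L₀ : ℕ, ∀ (L : ℕ) [NeZero L], L₀ ≤ L →
          (hubbardTorus 2 L 1 U - ((g / (L : ℝ) ^ 2 : ℝ) : ℂ) •
              ((pairField dWaveFormFactor L)ᴴ * pairField dWaveFormFactor L)).minEnergyOn
              (szSector (Λ := FermionTorus 2 L) (2 * ⌊(1 - δ) * (L : ℝ) ^ 2 / 2⌋₊) 0) -
              μ * (2 * (⌊(1 - δ) * (L : ℝ) ^ 2 / 2⌋₊ : ℝ)) ≤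
            (hubbardTorusWith 2 L 1 U μ - ((g / (L : ℝ) ^ 2 : ℝ) : ℂ) •
              ((pairField dWaveFormFactor L)ᴴ * pairField dWaveFormFactor L)).groundEnergy +
              κ * (L : ℝ) ^ 2) :
    TwSeededEnsembleEquivalenceR := by
  refine twR_of_hullTouchT0Floor fun δ hδ => ?_
  obtain ⟨μ₁, μ₂, hμ₁, hμ₁₂, hμ₂, K', U₀, hK', hU₀, hmain⟩ := hH δ hδ
  exact ⟨μ₁, μ₂, hμ₁, hμ₁₂, hμ₂, K', U₀, hK', hU₀, fun U hU g hg =>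
    seeded_hullTouchT0Strong_of_hullTouchT0 hδ (hmain U hU g hg)⟩

/-- **Per-instance T = 0 shadow of a crux instance:** the defect inequality at `(β, μ, ε, L)` forces the
T = 0 hull defect at slope `μ` to be at most `(log 4/β + ε) L²` (keep the ground-state term:
`−β E₀ ≤ log Re Z_β`). [folklore] -/
theorem hullDefect_le_of_instance (L : ℕ) [NeZero L] {δ U g μ β ε : ℝ} (hβ : 0 < β)
    (h : ((hubbardTorus 2 L 1 U - ((g / (L : ℝ) ^ 2 : ℝ) : ℂ) •
        ((pairField dWaveFormFactor L)ᴴ * pairField dWaveFormFactor L)).minEnergyOn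
          (szSector (Λ := FermionTorus 2 L) (2 * ⌊(1 - δ) * (L : ℝ) ^ 2 / 2⌋₊) 0) / (L : ℝ) ^ 2) +
      (Real.log (Matrix.partitionFn β (hubbardTorusWith 2 L 1 U μ - ((g / (L : ℝ) ^ 2 : ℝ) : ℂ) •
        ((pairField dWaveFormFactor L)ᴴ * pairField dWaveFormFactor L))).re / (β * (L : ℝ) ^ 2)) -
      μ * ((2 * ⌊(1 - δ) * (L : ℝ) ^ 2 / 2⌋₊) : ℝ) / (L : ℝ) ^ 2 ≤ Real.log 4 / β + ε) :
    (hubbardTorus 2 L 1 U - ((g / (L : ℝ) ^ 2 : ℝ) : ℂ) •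
          ((pairField dWaveFormFactor L)ᴴ * pairField dWaveFormFactor L)).minEnergyOn
          (szSector (Λ := FermionTorus 2 L) (2 * ⌊(1 - δ) * (L : ℝ) ^ 2 / 2⌋₊) 0) -
          μ * (2 * (⌊(1 - δ) * (L : ℝ) ^ 2 / 2⌋₊ : ℝ)) ≤
        (hubbardTorusWith 2 L 1 U μ - ((g / (L : ℝ) ^ 2 : ℝ) : ℂ) •
          ((pairField dWaveFormFactor L)ᴴ * pairField dWaveFormFactor L)).groundEnergy +
          (Real.log 4 / β + ε) * (L : ℝ) ^ 2 := by
  have hLpos : (0 : ℝ) < (L : ℝ) ^ 2 := cast_sq_pos_of_neZero L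
  have hL0 : (L : ℝ) ≠ 0 := fun h0 => by rw [h0] at hLpos; simp at hLpos
  set Z := Real.log ((hubbardTorusWith 2 L 1 U μ - ((g / (L : ℝ) ^ 2 : ℝ) : ℂ) •
      ((pairField dWaveFormFactor L)ᴴ * pairField dWaveFormFactor L)).partitionFn β).re
  set A := (hubbardTorus 2 L 1 U - ((g / (L : ℝ) ^ 2 : ℝ) : ℂ) •
      ((pairField dWaveFormFactor L)ᴴ * pairField dWaveFormFactor L)).minEnergyOn
      (szSector (Λ := FermionTorus 2 L) (2 * ⌊(1 - δ) * (L : ℝ) ^ 2 / 2⌋₊) 0)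
  set E₀ := (hubbardTorusWith 2 L 1 U μ - ((g / (L : ℝ) ^ 2 : ℝ) : ℂ) •
      ((pairField dWaveFormFactor L)ᴴ * pairField dWaveFormFactor L)).groundEnergy
  set ν := 2 * (⌊(1 - δ) * (L : ℝ) ^ 2 / 2⌋₊ : ℝ)
  have hZ : -(β * E₀) ≤ Z := neg_mul_groundEnergy_le_log_partitionFn (isHermitian_seededGC L U μ g) β
  have hZ' : -(E₀ / (L : ℝ) ^ 2) ≤ Z / (β * (L : ℝ) ^ 2) := by
    rw [le_div_iff₀ (mul_pos hβ hLpos)]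
    have : -(E₀ / (L : ℝ) ^ 2) * (β * (L : ℝ) ^ 2) = -(β * E₀) := by
      field_simp
    linarith
  have hmain : A / (L : ℝ) ^ 2 - E₀ / (L : ℝ) ^ 2 - μ * ν / (L : ℝ) ^ 2 ≤ Real.log 4 / β + ε := by
    linarith
  have : (A - E₀ - μ * ν) / (L : ℝ) ^ 2 ≤ Real.log 4 / β + ε := by
    rw [sub_div, sub_div]; exact hmain
  rw [div_le_iff₀ hLpos] at this
  linarith

/-- **The T = 0 content of R (necessary condition).** `TwSeededEnsembleEquivalenceR` forces, for every
`δ` in the window, a `δ`-window, `a, K', U₀ > 0` and for all admissible `U, g` ONE slope `μ ∈ [μ₁, μ₂]`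
with T = 0 hull defect `E_{N_L} − μ N_L − E₀(H_can − μN̂) ≤ (log 4 · e^{−a/U} + κ) L²` for every `κ > 0`,
eventually in `L`: the hull touch on floor seeds up to an EXPONENTIALLY SMALL tolerance (read at the cold
slice `β = e^{a/U}`). Together with `twR_of_hullTouchT0Floor` this brackets R between two temperature-free
statements. [folklore] -/
theorem hullDefect_le_of_twR (h : TwSeededEnsembleEquivalenceR) :
    ∀ δ ∈ Set.Icc (1/10 : ℝ) (2/5 : ℝ), ∃ μ₁ μ₂ : ℝ, -4 < μ₁ ∧ μ₁ ≤ μ₂ ∧ μ₂ < 0 ∧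
      ∃ a K' U₀ : ℝ, 0 < a ∧ 0 < K' ∧ 0 < U₀ ∧ ∀ U ∈ Set.Ioc (0 : ℝ) U₀,
        ∀ g ∈ Set.Icc (K' * U) (1 / 10), ∃ μ ∈ Set.Icc μ₁ μ₂, ∀ κ : ℝ, 0 < κ →
          ∃ L₀ : ℕ, ∀ (L : ℕ) [NeZero L], L₀ ≤ L →
            (hubbardTorus 2 L 1 U - ((g / (L : ℝ) ^ 2 : ℝ) : ℂ) •
                ((pairField dWaveFormFactor L)ᴴ * pairField dWaveFormFactor L)).minEnergyOn
                (szSector (Λ := FermionTorus 2 L) (2 * ⌊(1 - δ) * (L : ℝ) ^ 2 / 2⌋₊) 0) -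
                μ * (2 * (⌊(1 - δ) * (L : ℝ) ^ 2 / 2⌋₊ : ℝ)) ≤
              (hubbardTorusWith 2 L 1 U μ - ((g / (L : ℝ) ^ 2 : ℝ) : ℂ) •
                ((pairField dWaveFormFactor L)ᴴ * pairField dWaveFormFactor L)).groundEnergy +
                (Real.log 4 * Real.exp (-(a / U)) + κ) * (L : ℝ) ^ 2 := by
  intro δ hδ
  obtain ⟨μ₁, μ₂, hμ₁, hμ₁₂, hμ₂, a, K', U₀, ha, hK', hU₀, hmain⟩ := (twR_iff_coldSlice.1 h) δ hδ
  refine ⟨μ₁, μ₂, hμ₁, hμ₁₂, hμ₂, a, K', U₀, ha, hK', hU₀, fun U hU g hg => ?_⟩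
  obtain ⟨μ, hμ, hcold⟩ := hmain U hU g hg
  refine ⟨μ, hμ, fun κ hκ => ?_⟩
  obtain ⟨L₀, hL₀⟩ := hcold κ hκ
  refine ⟨L₀, fun L _ hL => ?_⟩
  have hβ0 : 0 < Real.exp (a / U) := Real.exp_pos _
  have key := hullDefect_le_of_instance L hβ0 (hL₀ L hL)
  have hexp : Real.log 4 / Real.exp (a / U) = Real.log 4 * Real.exp (-(a / U)) := by
    rw [Real.exp_neg, div_eq_mul_inv]
  rw [hexp] at key
  exact key

end

end Summit.HubbardSuperconductivity.HubbardSuperconductivity.Theorems.TwSeededEnsembleEquivalenceR.ColdFloor
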